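import Literature.NumberTheory.Automorphic.IsAutomorphicAE
import Literature.NumberTheory.Automorphic.LocalLanglandsDatum
import Literature.NumberTheory.Automorphic.LocalComponentBJ
import Literature.NumberTheory.Automorphic.AdicCompletionLocalField
import Literature.NumberTheory.Automorphic.SpecialRepresentationGL2
import Literature.NumberTheory.Automorphic.HilbertPartialHasseWeightShifting
import Literature.NumberTheory.GaloisRepresentations.WeilDeligneOfGalois
import HarnessLib

/-!
# Galois representations of Hilbert cuspidal eigenforms of PARTIAL weight one (Jarvis 1997;
# Rogawski–Tunnell 1983, Ohta; Newton 2015, Thm. 1): existence, and local–global compatibility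
# away from `ℓ` at the places where `π` is not special

Topic `Literature/NumberTheory/Automorphic` (companion of `HilbertModularGaloisRep` — existence and
irreducibility for REGULAR weights `k_β ≥ 2`, the case `n = 2` of lang.S27 — and of
`HilbertModularLocalGlobal` — Skinner's compatibility at every finite place for regular weights).
TWO NAMED FACTS (D-0014), no proofs; vendored by a grounder for route `Langlands/SenNullAlignment`
(items `SenNullAlignment.OddNonRegularAttached`, `SenNullAlignment.AwayFromEll`).

## The printed theorems

* F. Jarvis, *On Galois representations associated to Hilbert modular forms*, J. reine angew.
  Math. 491 (1997) 199–216 [Jarvis1997; held: `paper:doi-10-1515-crll-1997-491-199`].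
  **Theorem 6.1** (p. 14 of the held text): "Let `f ∈ S*_{k,w}(𝔫; 𝒪_K)` be a Hilbert cuspidal
  eigenform of partial weight one.  Then, if `λ` is a prime of `𝒪_K`, there exists a continuous
  representation `ρ_λ : Gal(F̄/F) → GL₂(𝒪_{K,λ})`, which is unramified outside `𝔫ℓ`, and
  satisfying 1. `det ρ_λ = χ` … `χ(Frob_𝔮) = θ_f(S_𝔮) N_{F/ℚ}(𝔮)` … 2. if `𝔮 ∤ 𝔫ℓ` is a prime of
  `F`, then `tr ρ_λ(Frob_𝔮) = θ_f(T_𝔮)`" (`Frob` = ARITHMETIC Frobenius, §7 p. 17; weights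
  `k ∈ ℤ^I_{≥ 1}` of constant parity, §1 p. 2; "The form of the following theorem is taken from
  Taylor [14]" — i.e. it is the statement of Carayol–Taylor–Blasius–Rogawski for `k ≥ 2t` extended
  to partial weight one; parallel weight one `k = t` is Rogawski–Tunnell [RogawskiTunnell1983] and
  Ohta, op. cit. p. 2 and p. 8).  **Theorem 7.2** (p. 17): "Conjecture 7.1 [`(ρ_λ|_{W_{F_𝔭}})^{F-ss}`
  is equivalent to `σ^λ(π_𝔭)` for every finite `𝔭 ∤ ℓ`, `σ` the HECKE-normalised local Langlands
  correspondence, Deligne 3.2.6] holds whenever `π_𝔭` is not special."  Remark 7.3: at special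
  `π_𝔭` only the semisimplification is identified ("we cannot show that `∗` should be
  non-trivial").  Irreducibility: "Ribet, in a letter to Carayol (unpublished), has proven that
  if the representations exist, then they are irreducible" (end of §3, p. 8).
* J. Newton, *Towards local-global compatibility for Hilbert modular forms of low weight*, Algebra
  & Number Theory 9 (2015) 957–980 [Newton2015LowWeight; held: `paper:arxiv-1409.6535`], **Theorem 1**
  (p. 3 of the held text), consolidating Carayol, Blasius–Rogawski, Rogawski–Tunnell, Taylor and
  Jarvis: "Let `π` be a cuspidal algebraic automorphic representation of `GL₂(𝔸_F)`, such that
  for [every] infinite place `τ` of `F` the local factor `π_τ` is either discrete series or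
  holomorphic limit of discrete series.  Then there exists an irreducible representation
  `r_{p,ι}(π) : Gal(F̄/F) → GL₂(ℚ̄_p)` such that if `v` is a finite place of `F`, with `v ∤ p`, and
  one of the following holds: • `π_τ` is discrete series for all infinite places `τ` • `π_v` is
  not special (i.e. `π_v` is not a twist of the Steinberg representation) then
  `WD(r_{p,ι}(π)|_{Gal(F̄_v/F_v)})^{F-ss} ≅ σ^ι(π_v)`"; Remark 2: "The irreducibility … is proved
  using an argument of Ribet (see [TaylorII])"; Remark 3 = Jarvis's Remark 7.3.  The excluded case
  (`π_v` special, some `π_τ` a limit of discrete series) is OPEN in general (Newton's Thm. 4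
  treats it under hypotheses at `p`; §1.1: "To handle the remaining cases seems to require a new
  idea").

## Rendering in the tree's vocabulary (read before reviewing)

Exactly the rendering of `HilbertModularLocalGlobal` / `HilbertModularGaloisRep` (module
docstrings there), which the reader should consult; only the differences are spelled out.

* **Holomorphic of weight `(k, w)`, limits of discrete series allowed.**  The tree records
  archimedean components through infinity types only (`AutomorphicRepData.HasInfinityType`).  The
  infinity type of weight `(k, w)` is the accepted `hilbertInfinityType k w`
  (`HilbertPartialHasseWeightShifting`): at `β` the two weights
  `((k_β-1-w)/2, (1-k_β-w)/2)`, `((1-k_β-w)/2, (k_β-1-w)/2)`.  For `k_β ≥ 2` this pins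
  `π_β ≅ D_{k_β}` up to the central twist (discrete series).  For `k_β = 1` the two weights
  COINCIDE and the infinity type is shared by the holomorphic limit of discrete series
  `Ind(μ, μ·sgn)` (central sign `-1`) and by the two even principal series `Ind(μ, μ)`,
  `Ind(μ sgn, μ sgn)` (central sign `+1`, the archimedean type of Maass forms of eigenvalue `1/4`);
  Newton's hypothesis "holomorphic limit of discrete series" is therefore rendered by the extra
  clause that the idèle `-1` at EVERY infinite place `u` acts by `-1` on `π = W / W'`
  (`R(-1_u) φ + φ ∈ W'`; at the places with `k_β ≥ 2` this is automatic, all `k_β` having the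
  parity of `w + 1` by `L`-algebraicity).  The idèle `-1` at `u` is written with Mathlib's
  `Units.map (MonoidHom.inl …) (Units.map (MonoidHom.mulSingle … u) (-1))` (definitionally the
  tree's `infiniteIdeleSingle u (-1)` of `BookerKrishnamurthyConverse`, not imported here), the
  very term of the route items.  A value `k_β = 0` is harmless: `hilbertInfinityType` gives at
  `β` the same multiset as `k_β = 2` (`hilbertArchWeights_zero_eq_two` below), a discrete series.
* **`L`-normalisation** (Buzzard–Gee), as in `HilbertModularLocalGlobal`: `π` is `L`-algebraic
  (`IsLAlgebraic`; so `k_β ≡ w + 1 (mod 2)`), `r` is attached to `π` by `SatakeFrobCompatibleAE ι π.1 r`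
  (arithmetic Frobenius polynomial `∏ (X - ι⁻¹(α_j⁻¹))`, no half-twist) and the local compatibility
  reads `ι WD(r|_{Γ_{F_v}})^{F-ss} ≅ rec_v(π_v)` UNTWISTED for Harris–Taylor's `rec_v`
  (`LocalLanglandsDatum`); Jarvis/Newton's `π'` (classical, `C`-algebraic, Hecke-normalised `σ`,
  `σ(π'_v) = rec_v(π'_v ⊗ |·|^{-1/2})`) is `π ⊗ |det|^{1/2}`.  For REGULAR weights this passage
  from the `C`-normalised lang.S27 is PROVED in the tree
  (`Summit…Theorems.exists_irreducible_satakeFrobCompatibleAE_GL2`, file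
  `WachComponentCensusLiftB2UnramSplitPInPrint`); here the `L`-normalised form is vendored directly.
* **"the" representation / `∃ llc`.**  As in `galoisRep_GL2_totallyReal_localGlobal`: existence is a
  separate fact (`exists_…` below, irreducible `r` — Newton Thm. 1 with Rem. 2); the compatibility
  fact is stated for EVERY irreducible `r` attached to `π` at almost all places (isomorphic to
  Jarvis's `ρ_λ ⊗ ℚ̄_ℓ` by Chebotarev and Brauer–Nesbitt, the proved
  `FramedGaloisRep.nonempty_equiv_of_hasFrobCharpolyAt_eventually`; all clauses are isomorphism
  invariants), and its `∃ llc` (Harris–Taylor's family `rec_v`) sits directly under `∀ K`.  Being a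
  separate `∃`, this `llc` is NOT syntactically the one of `galoisRep_GL2_totallyReal_localGlobal`;
  a consumer needing both for one family must add Henniart's uniqueness of `rec_v` (not in the
  tree) — recorded, not hidden.  To soften this the compatibility fact below is stated for ALL
  holomorphic weights `(k, w)` (Newton's Thm. 1 covers `π_τ` discrete series everywhere as its
  first bullet), so ONE `llc` serves regular holomorphic AND partial weight one `π` at `v ∤ ℓ`.
* **"not special"** is the accepted `AutomorphicRepData.IsSpecialAt` (`SpecialRepresentationGL2`,
  citing exactly Newton's Thm. 1 / Rem. 3 for the phrase).
* The clauses at `v ∤ ℓ` are, symbol for symbol, those of `galoisRep_GL2_totallyReal_localGlobal`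
  (and of the summit's `LocalGlobalCompatibleAt`) with the two `v ∣ ℓ` conjuncts removed.

## What is NOT here

* Anything at `v ∣ ℓ` (de Rhamness, Hodge–Tate or Sen weights, crystalline periods:
  Boxer–Pilloni 2021 Thm. "23"/351 (3)–(4), conditional there on Mok; not vendored).
* The special places of partial weight one forms (open; Newton 2015 Thm. 4 under hypotheses).
* Finiteness of the image in parallel weight one (Rogawski–Tunnell; not needed by the consumers).

## References

* F. Jarvis, J. reine angew. Math. 491 (1997) 199–216, Thm. 6.1, Thm. 7.2, Rem. 7.3, end of §3. [Jarvis1997]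
* J. Newton, Algebra Number Theory 9 (2015) 957–980, Thm. 1, Rem. 2–3, §1.1. [Newton2015LowWeight]
* J. Rogawski, J. Tunnell, Invent. Math. 74 (1983) 1–42. [RogawskiTunnell1983]
* R. Taylor, Invent. Math. 98 (1989) 265–280. [TaylorInventMath1989]
* M. Harris, R. Taylor, Ann. of Math. Stud. 151 (2001), Thm. A. [HarrisTaylorAMS2001]
-/

noncomputable section

open scoped MatrixGroups Matrix NumberField
open NumberField IsDedekindDomain Field Filter

-- as in the accepted `LocalComponentBJ` / `SpecialRepresentationGL2`: the place types indexing the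
-- infinite adèle ring are `DecidableEq` / `Fintype` classically (needed by `MonoidHom.mulSingle`)
open scoped Classical

namespace Literature.NumberTheory.Automorphic

open Literature.NumberTheory.GaloisRepresentations

/-- Sanity check for the rendering: the weight-`(0, w)` archimedean pair is the weight-`(2, w)` pair
(the multiset `{(a, b), (b, a)}` is symmetric), so a value `k_β = 0` of the weight function encodes a
discrete series of weight `2`, never a degenerate type. [folklore] -/
theorem hilbertArchWeights_zero_eq_two (w : ℤ) : hilbertArchWeights 0 w = hilbertArchWeights 2 w := by
  have ha : hilbertArchWeight 0 w = (hilbertArchWeight 2 w).swap := by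
    ext <;> simp [hilbertArchWeight_a, hilbertArchWeight_b] <;> ring
  have hb : (hilbertArchWeight 0 w).swap = hilbertArchWeight 2 w := by
    rw [ha, ArchWeight.swap_swap]
  simp only [hilbertArchWeights, ha, ArchWeight.swap_swap]
  exact Multiset.pair_comm _ _

/-- **Galois representations exist for holomorphic Hilbert cuspidal eigenforms of partial weight
one** (Jarvis 1997, Thm. 6.1; parallel weight one: Rogawski–Tunnell 1983, Ohta; regular weights:
Carayol, Taylor 1989, Blasius–Rogawski; irreducibility: Ribet's argument, Jarvis 1997 end of §3 and
Newton 2015 Rem. 2 — consolidated statement: Newton 2015, Thm. 1), in Buzzard–Gee's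
`L`-normalisation and the tree's vocabulary (module docstring, "Rendering").  For `K` totally real,
every cuspidal automorphic representation `π` of `GL₂(𝔸_K)` which is `L`-algebraic, has the
infinity type `hilbertInfinityType k w` of a holomorphic form of weight `(k, w)`
(`k_β ≥ 1` arbitrary, SOME `k_β` may equal `1`) and on which the idèle `-1` at every infinite place
acts by `-1` (holomorphic limits of discrete series at the weight-one places), every prime `ℓ` and
every `ι : ℚ̄_ℓ ≃ ℂ`: there is a continuous IRREDUCIBLE `r : Γ_K → GL₂(ℚ̄_ℓ)` attached to `π` at
almost all finite places — `π_v` unramified with Satake parameter `α`, `r` unramified at `v`, and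
the arithmetic Frobenius has characteristic polynomial `∏ (X - ι⁻¹(α_j⁻¹))`
(`SatakeFrobCompatibleAE`).  Named fact (D-0014), `∀ hcpt`.  Grounds
`Summit.Langlands.Langlands.Theses.SenNullAlignment.OddNonRegularAttached` (that item is this fact
instantiated; its Satake clause is `SatakeFrobCompatibleAE` unfolded).
[cite: Jarvis1997, Thm. 6.1 (and end of §3)] [cite: Newton2015LowWeight, Thm. 1 and Rem. 2] -/
def exists_galoisRep_GL2_totallyReal_partialWeightOne : Prop :=
  ∀ (K : Type) [Field K] [NumberField K], IsTotallyReal K →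
    ∀ (hcpt : isCompact_glFiniteIntegralLevel 2 K) (π : CuspidalAutomorphicRepData 2 K hcpt)
      (k : (K →+* ℂ) → ℕ) (w : ℤ), π.1.IsLAlgebraic → π.1.HasInfinityType (hilbertInfinityType k w) →
      (∀ (u : InfinitePlace K), ∀ φ ∈ π.1.W,
        rightTranslation (AdelicGroupData.gl 2 K) (Matrix.GeneralLinearGroup.scalar (Fin 2)
          (Units.map (MonoidHom.inl (InfiniteAdeleRing K) (FiniteAdeleRing (𝓞 K) K) :
              InfiniteAdeleRing K →* AdeleRing (𝓞 K) K)
            (Units.map (MonoidHom.mulSingle (fun u' : InfinitePlace K => u'.Completion) u :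
                u.Completion →* InfiniteAdeleRing K) (-1)))) φ + φ ∈ π.1.W') →
      ∀ (ℓ : ℕ) [Fact ℓ.Prime] (ι : PadicAlgCl ℓ ≃+* ℂ),
        ∃ r : FramedGaloisRep K (PadicAlgCl ℓ) 2,
          r.toGaloisRep.IsIrreducible ∧ SatakeFrobCompatibleAE ι π.1 r

/-- **Local–global compatibility away from `ℓ`, at the non-special places, for the Galois
representations of holomorphic Hilbert cuspidal eigenforms of arbitrary (possibly partial weight
one) weight** (Jarvis 1997, Thm. 7.2 with Rem. 7.3; regular weights: Carayol 1986 Thm. (A), Taylor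
1989; parallel weight one: Rogawski–Tunnell 1983 — consolidated statement: Newton 2015, Thm. 1),
in Buzzard–Gee's `L`-normalisation and the tree's vocabulary (module docstring, "Rendering").
For every totally real `K` there is a family of local Langlands correspondences `llc v` of the
completions `K_v` (Harris–Taylor's `rec_v`, geometric Frobenius ↦ uniformiser) such that: for every
cuspidal `π` on `GL₂(𝔸_K)`, `L`-algebraic, of infinity type `hilbertInfinityType k w`, with the idèle
`-1` at every infinite place acting by `-1`, every `ℓ`, `ι : ℚ̄_ℓ ≃ ℂ`, every continuous irreducible
`r : Γ_K → GL₂(ℚ̄_ℓ)` attached to `π` at almost all places (`SatakeFrobCompatibleAE`), and every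
finite place `v ∤ ℓ` such that EITHER no `k_β` equals `1` (`π_τ` discrete series at all infinite
`τ`) OR `π` is not special at `v` (`¬ IsSpecialAt`: `π_v` is not a twist of Steinberg): there are the
local component `π_v` of `π` (`HasLocalComponentAt`), the Weil–Deligne representation
`r_v = WD(r|_{Γ_{K_v}})` (Grothendieck–Deligne, `IsWeilDeligneOfLadic`) and its transport `ι(r_v)`
(`IsTransportAlong`) with `ι(r_v)^{F-ss} ≅ rec_v(π_v)` (`HasFrobSemisimpleClass`).  The excluded case
(`π_v` special and some `k_β = 1`) is open (Newton 2015 §1.1, Thm. 4 under hypotheses).  Named fact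
(D-0014), `∀ hcpt`.  Grounds the in-print part of
`Summit.Langlands.Langlands.Theses.SenNullAlignment.AwayFromEll` (that item is STRONGER: it asks the
clause for every `RD` serving the regular case, and also at the special places).
[cite: Jarvis1997, Thm. 7.2 and Rem. 7.3] [cite: Newton2015LowWeight, Thm. 1 and Rem. 3]
[cite: CarayolASENS1986, Thm. (A) (pp. 410–411)] [cite: HarrisTaylorAMS2001, Thm. A] -/
def galoisRep_GL2_totallyReal_holomorphic_localGlobal_awayFromEll : Prop :=
  ∀ (K : Type) [Field K] [NumberField K], IsTotallyReal K →
    ∃ llc : ∀ v : HeightOneSpectrum (𝓞 K), LocalLanglandsDatum (v.adicCompletion K),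
      ∀ (hcpt : isCompact_glFiniteIntegralLevel 2 K) (π : CuspidalAutomorphicRepData 2 K hcpt)
        (k : (K →+* ℂ) → ℕ) (w : ℤ), π.1.IsLAlgebraic →
        π.1.HasInfinityType (hilbertInfinityType k w) →
        (∀ (u : InfinitePlace K), ∀ φ ∈ π.1.W,
          rightTranslation (AdelicGroupData.gl 2 K) (Matrix.GeneralLinearGroup.scalar (Fin 2)
            (Units.map (MonoidHom.inl (InfiniteAdeleRing K) (FiniteAdeleRing (𝓞 K) K) :
                InfiniteAdeleRing K →* AdeleRing (𝓞 K) K)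
              (Units.map (MonoidHom.mulSingle (fun u' : InfinitePlace K => u'.Completion) u :
                  u.Completion →* InfiniteAdeleRing K) (-1)))) φ + φ ∈ π.1.W') →
        ∀ (ℓ : ℕ) [Fact ℓ.Prime] (ι : PadicAlgCl ℓ ≃+* ℂ) (r : FramedGaloisRep K (PadicAlgCl ℓ) 2),
          r.toGaloisRep.IsIrreducible → SatakeFrobCompatibleAE ι π.1 r →
          ∀ v : HeightOneSpectrum (𝓞 K), ((ℓ : ℕ) : 𝓞 K) ∉ v.asIdeal →
            ((∀ β : K →+* ℂ, k β ≠ 1) ∨ ¬ π.1.IsSpecialAt v) →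
            ∃ (πv : SmoothIrrep (GL (Fin 2) (v.adicCompletion K)))
              (rv : WeilDeligneRep (v.adicCompletion K) (PadicAlgCl ℓ) (Fin 2 → PadicAlgCl ℓ))
              (rℂ : WeilDeligneRep (v.adicCompletion K) ℂ (Fin 2 → ℂ)),
              π.1.HasLocalComponentAt v πv.ρ ∧
              IsWeilDeligneOfLadic (r.toLocal v).toWeilGroupHom rv ∧
              rv.IsTransportAlong (ι : PadicAlgCl ℓ →+* ℂ) rℂ ∧
              rℂ.HasFrobSemisimpleClass ((llc v).recGL 2 (IrrClass.mk πv))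

end Literature.NumberTheory.Automorphic

end
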